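import Literature.NumberTheory.LFunctions.SelbergArgOmegaKernel
import Literature.NumberTheory.LFunctions.ZetaArgVariation
import Literature.NumberTheory.LFunctions.ZetaZeroOrdinateSums
import HarnessLib

/-!
# The smoothed `S(t+h) − S(t)` on `[T, 2T]`: the counting side

Topic `Literature/NumberTheory/LFunctions`. Everything in this file is PROVED (no definitions, no
named facts).

With the window kernel `K_τ = kerDil τ` of the tree (`SelbergArgOmegaKernel.lean`) put, for a
function `f` on `[T, 2T]` and `u` real, `(K_τ ⋆_T f)(u) = ∫_T^{2T} K_τ(t − u) f(t) dt`. This file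
computes `K_τ ⋆_T (N(·+h) − N(·))` as a finite sum over the zeros with `0 < γ ≤ 2T + h`
(`integral_kerDil_mul_deltaN_eq_sum`), compares it with the zero side
`∑_ρ m(ρ) ∫_u^{u+h} K_τ(γ − t) dt` of the integrated explicit formula
(`SelbergDeltaExplicit.lean`): the two agree zero by zero for the zeros with
`T + h ≤ γ ≤ 2T` (`interior_term_eq`), and the remaining zeros contribute, for `u ∈ [9T/8, 15T/8]`,
at most `O(h (log T)/(τ √T))` (`norm_remainder_le`), by the decay `K_τ(v) ≤ τC/(1+τ²v²)²` and the
local count of zeros (`ZetaZeroOrdinateSums.lean`).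

## References

* E. C. Titchmarsh, *The Theory of the Riemann Zeta-Function*, 2nd ed. (1986), §9.26.
  [cite: Titchmarsh1986, §9.26]
* A. Selberg, *Contributions to the theory of the Riemann zeta-function* (1946), §§5–7.
-/

noncomputable section

open Complex Real MeasureTheory Set Filter intervalIntegral
open scoped Topology

namespace Literature.NumberTheory.LFunctions.SelbergDelta

open Literature.NumberTheory.LFunctions.SelbergOmega
open Literature.NumberTheory.LFunctions.ZeroOrdinateSums

/-! ### `N` as a finite sum over the zeros up to a fixed height -/

/-- For `0 ≤ s ≤ T_m`: `N(s) = ∑_{ρ ∈ box(T_m)} m(ρ) 1[γ ≤ s]`. [folklore] -/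
theorem zetaZeroCount_eq_sum {Tm s : ℝ} (hsT : s ≤ Tm) :
    (zetaZeroCount s : ℝ) =
      ∑ ρ ∈ (zetaZeroBox_finite 0 Tm).toFinset, (riemannZetaZeroOrder ρ : ℝ) * (if ρ.im ≤ s then 1 else 0) := by
  have h := zetaZeroCount_eq_finsum s
  have hsub : zetaZeroBox 0 s = {ρ ∈ zetaZeroBox 0 Tm | ρ.im ≤ s} := by
    ext ρ; simp only [zetaZeroBox, Set.mem_setOf_eq]
    constructor
    · rintro ⟨h1, h2, h3, h4, h5⟩; exact ⟨⟨h1, h2, h3, h4, h5.trans hsT⟩, h5⟩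
    · rintro ⟨⟨h1, h2, h3, h4, -⟩, h5⟩; exact ⟨h1, h2, h3, h4, h5⟩
  have hfin : (zetaZeroBox 0 s).Finite := zetaZeroBox_finite 0 s
  rw [finsum_mem_eq_finite_toFinset_sum _ hfin] at h
  have hcast : (zetaZeroCount s : ℝ) = ((zetaZeroCount s : ℤ) : ℝ) := by simp
  rw [hcast, h]
  push_cast
  rw [show (∑ ρ ∈ (zetaZeroBox_finite 0 Tm).toFinset, (riemannZetaZeroOrder ρ : ℝ) * (if ρ.im ≤ s then 1 else 0)) =
      ∑ ρ ∈ (zetaZeroBox_finite 0 Tm).toFinset.filter (fun ρ => ρ.im ≤ s), (riemannZetaZeroOrder ρ : ℝ) by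
    rw [Finset.sum_filter]
    refine Finset.sum_congr rfl fun ρ _ => ?_
    split_ifs <;> simp]
  refine Finset.sum_congr ?_ fun _ _ => rfl
  ext ρ
  rw [Set.Finite.mem_toFinset, Finset.mem_filter, Set.Finite.mem_toFinset, hsub]
  rfl

/-- The increment of `N`: for `0 ≤ h`, `t + h ≤ T_m`,
`N(t+h) − N(t) = ∑_{ρ ∈ box(T_m)} m(ρ) 1[γ − h ≤ t < γ]`. [folklore] -/
theorem deltaN_eq_sum {Tm t h : ℝ} (hth : t + h ≤ Tm) (hh : 0 ≤ h) :
    (zetaZeroCount (t + h) : ℝ) - zetaZeroCount t =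
      ∑ ρ ∈ (zetaZeroBox_finite 0 Tm).toFinset, (riemannZetaZeroOrder ρ : ℝ) *
        Set.indicator (Set.Ico (ρ.im - h) ρ.im) (fun _ => (1 : ℝ)) t := by
  rw [zetaZeroCount_eq_sum hth, zetaZeroCount_eq_sum (show t ≤ Tm by linarith), ← Finset.sum_sub_distrib]
  refine Finset.sum_congr rfl fun ρ _ => ?_
  rw [← mul_sub]
  congr 1
  by_cases h1 : ρ.im ≤ t + h <;> by_cases h2 : ρ.im ≤ t <;> simp only [h1, h2, if_true, if_false, Set.indicator, Set.mem_Ico]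
  · rw [if_neg (by push Not; intro _; linarith)]; simp
  · rw [if_pos ⟨by linarith, by linarith⟩]; simp
  · exact absurd (h2.trans (by linarith)) h1
  · rw [if_neg (by push Not; intro h3; linarith)]; simp

/-! ### The smoothed increment of `N` as a sum over the zeros -/

/-- Interval integrability of `t ↦ K_τ(t − u) 1_{[γ−h, γ)}(t)`. [folklore] -/
theorem intervalIntegrable_kerDil_indicator (τ u a b c₁ c₂ : ℝ) :
    IntervalIntegrable (fun t : ℝ => kerDil τ (t - u) * Set.indicator (Set.Ico c₁ c₂) (fun _ => (1 : ℝ)) t) volume a b := by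
  have h1 : IntervalIntegrable (fun t : ℝ => kerDil τ (t - u)) volume a b :=
    ((continuous_kerDil τ).comp (continuous_id.sub continuous_const)).intervalIntegrable _ _
  rw [intervalIntegrable_iff] at h1 ⊢
  have h2 := h1.bdd_mul (f := fun t : ℝ => Set.indicator (Set.Ico c₁ c₂) (fun _ => (1 : ℝ)) t) (c := 1)
    ((measurable_const.indicator measurableSet_Ico).aestronglyMeasurable) (ae_of_all _ fun t => by
      simp only [Set.indicator]; split_ifs <;> simp)
  exact h2.congr (ae_of_all _ fun t => mul_comm _ _)

/-- **`K_τ ⋆_T ΔN` as a sum over the zeros**: for `0 ≤ h`, `0 ≤ T`,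
`∫_T^{2T} K_τ(t−u)(N(t+h)−N(t)) dt = ∑_{ρ ∈ box(2T+h)} m(ρ) ∫_T^{2T} K_τ(t−u) 1_{[γ−h,γ)}(t) dt`. [folklore] -/
theorem integral_kerDil_mul_deltaN_eq_sum (τ u : ℝ) {T h : ℝ} (hT : 0 ≤ T) (hh : 0 ≤ h) :
    ∫ t in T..2 * T, kerDil τ (t - u) * ((zetaZeroCount (t + h) : ℝ) - zetaZeroCount t) =
      ∑ ρ ∈ (zetaZeroBox_finite 0 (2 * T + h)).toFinset, (riemannZetaZeroOrder ρ : ℝ) *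
        ∫ t in T..2 * T, kerDil τ (t - u) * Set.indicator (Set.Ico (ρ.im - h) ρ.im) (fun _ => (1 : ℝ)) t := by
  have hpt : ∀ t ∈ Set.uIcc T (2 * T), kerDil τ (t - u) * ((zetaZeroCount (t + h) : ℝ) - zetaZeroCount t) =
      ∑ ρ ∈ (zetaZeroBox_finite 0 (2 * T + h)).toFinset, (riemannZetaZeroOrder ρ : ℝ) *
        (kerDil τ (t - u) * Set.indicator (Set.Ico (ρ.im - h) ρ.im) (fun _ => (1 : ℝ)) t) := by
    intro t ht
    rw [Set.uIcc_of_le (by linarith)] at ht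
    rw [deltaN_eq_sum (Tm := 2 * T + h) (by linarith [ht.2]) hh, Finset.mul_sum]
    refine Finset.sum_congr rfl fun ρ _ => by ring
  rw [intervalIntegral.integral_congr hpt, intervalIntegral.integral_finsetSum]
  · refine Finset.sum_congr rfl fun ρ _ => ?_
    rw [intervalIntegral.integral_const_mul]
  · intro ρ _
    exact (intervalIntegrable_kerDil_indicator τ u T (2 * T) _ _).const_mul _

/-! ### The interior zeros: exact agreement with the explicit formula -/

/-- For an interior zero (`T ≤ γ − h`, `γ ≤ 2T`):
`∫_T^{2T} K_τ(t−u) 1_{[γ−h,γ)}(t) dt = ∫_u^{u+h} K_τ(γ − t) dt`. [folklore] -/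
theorem interior_term_eq (τ u : ℝ) {T h γ : ℝ} (hh : 0 ≤ h) (h1 : T ≤ γ - h) (h2 : γ ≤ 2 * T) :
    ∫ t in T..2 * T, kerDil τ (t - u) * Set.indicator (Set.Ico (γ - h) γ) (fun _ => (1 : ℝ)) t =
      ∫ t in u..u + h, kerDil τ (γ - t) := by
  -- restrict to `[γ − h, γ]`
  have hsplit := intervalIntegral.integral_add_adjacent_intervals
    (intervalIntegrable_kerDil_indicator τ u T (γ - h) (γ - h) γ)
    (intervalIntegrable_kerDil_indicator τ u (γ - h) (2 * T) (γ - h) γ)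
  have hsplit2 := intervalIntegral.integral_add_adjacent_intervals
    (intervalIntegrable_kerDil_indicator τ u (γ - h) γ (γ - h) γ)
    (intervalIntegrable_kerDil_indicator τ u γ (2 * T) (γ - h) γ)
  rw [← hsplit, ← hsplit2]
  -- the pieces outside `[γ−h, γ]` vanish
  have hz1' : ∫ t in T..γ - h, kerDil τ (t - u) * Set.indicator (Set.Ico (γ - h) γ) (fun _ => (1 : ℝ)) t = 0 := by
    rw [intervalIntegral.integral_of_le h1, MeasureTheory.integral_Ioc_eq_integral_Ioo]
    refine setIntegral_eq_zero_of_forall_eq_zero fun t ht => ?_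
    have hnot : t ∉ Set.Ico (γ - h) γ := fun h' => by have := (Set.mem_Ico.1 h').1; linarith [ht.2]
    rw [Set.indicator_of_notMem hnot, mul_zero]
  have hz2 : ∫ t in γ..2 * T, kerDil τ (t - u) * Set.indicator (Set.Ico (γ - h) γ) (fun _ => (1 : ℝ)) t = 0 := by
    rw [intervalIntegral.integral_of_le h2]
    refine setIntegral_eq_zero_of_forall_eq_zero fun t ht => ?_
    have hnot : t ∉ Set.Ico (γ - h) γ := fun h' => by have := (Set.mem_Ico.1 h').2; linarith [ht.1]
    rw [Set.indicator_of_notMem hnot, mul_zero]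
  rw [hz1', hz2, zero_add, add_zero]
  -- on `(γ−h, γ]` the indicator is `1` a.e. (except at `t = γ`)
  have hmid : ∫ t in γ - h..γ, kerDil τ (t - u) * Set.indicator (Set.Ico (γ - h) γ) (fun _ => (1 : ℝ)) t =
      ∫ t in γ - h..γ, kerDil τ (t - u) := by
    rw [intervalIntegral.integral_of_le (by linarith), intervalIntegral.integral_of_le (by linarith),
      MeasureTheory.integral_Ioc_eq_integral_Ioo, MeasureTheory.integral_Ioc_eq_integral_Ioo]
    refine setIntegral_congr_fun measurableSet_Ioo fun t ht => ?_
    rw [Set.indicator_of_mem (Set.mem_Ico.2 ⟨ht.1.le, ht.2⟩), mul_one]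
  rw [hmid]
  -- substitute `t = γ + u − s`... both sides are `∫_{γ−h−u}^{γ−u} K_τ`
  have e1 : ∫ t in γ - h..γ, kerDil τ (t - u) = ∫ x in γ - h - u..γ - u, kerDil τ x := by
    rw [intervalIntegral.integral_comp_sub_right (fun x => kerDil τ x) u]
  have e2 : ∫ t in u..u + h, kerDil τ (γ - t) = ∫ x in γ - (u + h)..γ - u, kerDil τ x := by
    rw [intervalIntegral.integral_comp_sub_left (fun x => kerDil τ x) γ]
  rw [e1, e2, show γ - (u + h) = γ - h - u by ring]

/-! ### Bounds for single-zero terms far from `u` -/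

/-- `K_τ(x) ≤ C/(4τ x²)` for `x ≠ 0`, `τ > 0` (from `K_τ(x) ≤ τC/(1+τ²x²)²` and `(1+a)² ≥ 4a`). [folklore] -/
theorem kerDil_le_div_sq {C τ x : ℝ} (hC : ∀ L : ℝ, 0 ≤ L → ∀ r : ℝ, kerDil L r ≤ L * C / (1 + (L * r) ^ 2) ^ 2)
    (hC0 : 0 ≤ C) (hτ : 0 < τ) (hx : x ≠ 0) : kerDil τ x ≤ C / (4 * τ * x ^ 2) := by
  have h := hC τ hτ.le x
  refine h.trans ?_
  have hx2 : 0 < x ^ 2 := by positivity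
  have ha : 4 * (τ * x) ^ 2 ≤ (1 + (τ * x) ^ 2) ^ 2 := by nlinarith [sq_nonneg ((τ * x) ^ 2 - 1)]
  rw [div_le_div_iff₀ (by positivity) (by positivity)]
  calc τ * C * (4 * τ * x ^ 2) = C * (4 * (τ * x) ^ 2) := by ring
    _ ≤ C * (1 + (τ * x) ^ 2) ^ 2 := mul_le_mul_of_nonneg_left ha hC0

/-- For `|γ − u| ≥ 2h`, `h ≥ 0`, and `x` with `|x − (γ − u)| ≤ h`... we use: if `|γ−u| ≥ 2` , `0 ≤ h ≤ 1`
and `t ∈ [u, u+h]` then `|γ − t| ≥ |γ − u|/2`. [folklore] -/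
theorem abs_sub_ge_half {γ u t h : ℝ} (hγ : 2 ≤ |γ - u|) (hh : h ≤ 1) (ht : t ∈ Set.Icc u (u + h)) :
    |γ - u| / 2 ≤ |γ - t| := by
  have h1 : |γ - u| ≤ |γ - t| + |t - u| := by
    have := abs_sub_le γ t u; linarith
  have h2 : |t - u| ≤ 1 := by rw [abs_of_nonneg (by linarith [ht.1])]; linarith [ht.2]
  linarith

/-- The explicit-formula window term of one zero: `|∫_u^{u+h} K_τ(γ−t) dt| ≤ h C/(τ (γ−u)²)` when
`|γ − u| ≥ 2`, `0 ≤ h ≤ 1`. [folklore] -/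
theorem abs_integral_window_le {C τ γ u h : ℝ}
    (hC : ∀ L : ℝ, 0 ≤ L → ∀ r : ℝ, kerDil L r ≤ L * C / (1 + (L * r) ^ 2) ^ 2) (hC0 : 0 ≤ C)
    (hτ : 0 < τ) (hh : 0 ≤ h) (hh1 : h ≤ 1) (hγ : 2 ≤ |γ - u|) :
    |∫ t in u..u + h, kerDil τ (γ - t)| ≤ h * (C / (τ * (γ - u) ^ 2)) := by
  have hb : ∀ t ∈ Set.uIoc u (u + h), ‖kerDil τ (γ - t)‖ ≤ C / (τ * (γ - u) ^ 2) := by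
    intro t ht
    rw [Set.uIoc_of_le (by linarith)] at ht
    have ht' : t ∈ Set.Icc u (u + h) := ⟨ht.1.le, ht.2⟩
    have hx := abs_sub_ge_half hγ hh1 ht'
    have hx0 : γ - t ≠ 0 := by
      intro h0; rw [h0, abs_zero] at hx; linarith
    rw [Real.norm_eq_abs, abs_of_nonneg (kerDil_nonneg hτ.le _)]
    refine (kerDil_le_div_sq hC hC0 hτ hx0).trans ?_
    have hp1 : 0 < 4 * τ * (γ - t) ^ 2 := by have := sq_pos_iff.2 hx0; positivity
    have hp2 : 0 < τ * (γ - u) ^ 2 := by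
      have hne : γ - u ≠ 0 := fun h0 => by rw [h0, abs_zero] at hγ; linarith
      have := sq_pos_iff.2 hne; positivity
    rw [div_le_div_iff₀ hp1 hp2]
    have : (γ - u) ^ 2 ≤ 4 * (γ - t) ^ 2 := by
      rw [← sq_abs (γ - u), ← sq_abs (γ - t)]; nlinarith [abs_nonneg (γ - u)]
    calc C * (τ * (γ - u) ^ 2) = (C * τ) * (γ - u) ^ 2 := by ring
      _ ≤ (C * τ) * (4 * (γ - t) ^ 2) := mul_le_mul_of_nonneg_left this (by positivity)
      _ = C * (4 * τ * (γ - t) ^ 2) := by ring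
  have := intervalIntegral.norm_integral_le_of_norm_le_const hb
  rw [Real.norm_eq_abs, show |u + h - u| = h by rw [add_sub_cancel_left, abs_of_nonneg hh]] at this
  linarith [this]

/-- The counting-side term of one zero: `|∫_T^{2T} K_τ(t−u) 1_{[γ−h,γ)}(t) dt| ≤ h C/(τ (γ−u)²)` when
`|γ − u| ≥ 2`, `0 ≤ h ≤ 1`, `0 ≤ T`. [folklore] -/
theorem abs_integral_count_le {C τ γ u h T : ℝ}
    (hC : ∀ L : ℝ, 0 ≤ L → ∀ r : ℝ, kerDil L r ≤ L * C / (1 + (L * r) ^ 2) ^ 2) (hC0 : 0 ≤ C)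
    (hτ : 0 < τ) (hh : 0 ≤ h) (hh1 : h ≤ 1) (hT : 0 ≤ T) (hγ : 2 ≤ |γ - u|) :
    |∫ t in T..2 * T, kerDil τ (t - u) * Set.indicator (Set.Ico (γ - h) γ) (fun _ => (1 : ℝ)) t| ≤
      h * (C / (τ * (γ - u) ^ 2)) := by
  set B := C / (τ * (γ - u) ^ 2) with hB
  have hγ0 : (γ - u) ^ 2 ≠ 0 := by
    intro h0; rw [sq_eq_zero_iff] at h0; rw [h0, abs_zero] at hγ; linarith
  have hB0 : 0 ≤ B := by rw [hB]; positivity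
  -- pointwise: `0 ≤ f ≤ B 1_{Ico}`
  have hpt : ∀ t : ℝ, |kerDil τ (t - u) * Set.indicator (Set.Ico (γ - h) γ) (fun _ => (1 : ℝ)) t| ≤
      Set.indicator (Set.Ico (γ - h) γ) (fun _ => B) t := by
    intro t
    by_cases ht : t ∈ Set.Ico (γ - h) γ
    · rw [Set.indicator_of_mem ht, Set.indicator_of_mem ht, mul_one, abs_of_nonneg (kerDil_nonneg hτ.le _)]
      -- `t ∈ [γ−h, γ)`: `|t − u − (γ − u)| ≤ h`, so `|t − u| ≥ |γ−u|/2`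
      have h1 : |γ - u| / 2 ≤ |t - u| := by
        have := abs_sub_le γ t u
        have h2 : |γ - t| ≤ 1 := by rw [abs_of_nonneg (by linarith [ht.2])]; linarith [ht.1]
        linarith
      have hx0 : t - u ≠ 0 := by intro h0; rw [h0, abs_zero] at h1; linarith
      refine (kerDil_le_div_sq hC hC0 hτ hx0).trans ?_
      have hp1 : 0 < 4 * τ * (t - u) ^ 2 := by have := sq_pos_iff.2 hx0; positivity
      have hp2 : 0 < τ * (γ - u) ^ 2 := by
        have hne : γ - u ≠ 0 := fun h0 => by rw [h0, abs_zero] at hγ; linarith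
        have := sq_pos_iff.2 hne; positivity
      rw [hB, div_le_div_iff₀ hp1 hp2]
      have : (γ - u) ^ 2 ≤ 4 * (t - u) ^ 2 := by
        rw [← sq_abs (γ - u), ← sq_abs (t - u)]; nlinarith [abs_nonneg (γ - u)]
      calc C * (τ * (γ - u) ^ 2) = (C * τ) * (γ - u) ^ 2 := by ring
        _ ≤ (C * τ) * (4 * (t - u) ^ 2) := mul_le_mul_of_nonneg_left this (by positivity)
        _ = C * (4 * τ * (t - u) ^ 2) := by ring
    · rw [Set.indicator_of_notMem ht, Set.indicator_of_notMem ht, mul_zero, abs_zero]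
  have hT2 : T ≤ 2 * T := by linarith
  calc |∫ t in T..2 * T, kerDil τ (t - u) * Set.indicator (Set.Ico (γ - h) γ) (fun _ => (1 : ℝ)) t|
      ≤ ∫ t in T..2 * T, |kerDil τ (t - u) * Set.indicator (Set.Ico (γ - h) γ) (fun _ => (1 : ℝ)) t| := by
        have := intervalIntegral.norm_integral_le_integral_norm (μ := volume)
          (f := fun t => kerDil τ (t - u) * Set.indicator (Set.Ico (γ - h) γ) (fun _ => (1 : ℝ)) t) hT2
        simpa only [Real.norm_eq_abs] using this
    _ ≤ ∫ t in T..2 * T, Set.indicator (Set.Ico (γ - h) γ) (fun _ => B) t := by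
        refine intervalIntegral.integral_mono_on hT2 (intervalIntegrable_kerDil_indicator τ u _ _ _ _).norm ?_
          (fun t _ => hpt t)
        rw [intervalIntegrable_iff]
        exact (integrableOn_const (by rw [Real.volume_uIoc]; exact ENNReal.ofReal_ne_top)).indicator measurableSet_Ico
    _ ≤ h * B := by
        rw [intervalIntegral.integral_of_le hT2, MeasureTheory.integral_indicator_const _ measurableSet_Ico, smul_eq_mul]
        refine mul_le_mul_of_nonneg_right ?_ hB0
        calc (volume.restrict (Set.Ioc T (2 * T))).real (Set.Ico (γ - h) γ)
            ≤ volume.real (Set.Ico (γ - h) γ) := by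
              rw [measureReal_restrict_apply measurableSet_Ico]
              exact measureReal_mono Set.inter_subset_left (by rw [Real.volume_Ico]; exact ENNReal.ofReal_ne_top)
          _ = h := by rw [Real.volume_real_Ico_of_le (by linarith)]; ring

/-! ### The remainder: zeros outside `[T+h, 2T]` -/

/-- Geometry of the non-interior zeros: for a non-trivial zero `ρ` which is not an interior zero of
`[T, 2T]` (i.e. not (`ρ ∈ box(2T+h)` and `T + h ≤ γ ≤ 2T`)), and `u ∈ [9T/8, 15T/8]`, `0 ≤ h ≤ 1`:
`|γ − u| ≥ T/8 − 1`. [folklore] -/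
theorem abs_im_sub_ge_of_not_interior {T h u : ℝ} (hT : 16 ≤ T) (hh : 0 ≤ h) (hh1 : h ≤ 1)
    (hu : u ∈ Set.Icc (9 * T / 8) (15 * T / 8)) {ρ : ℂ} (hρ : ρ ∈ ZetaZeros.riemannZetaNontrivialZeros)
    (hni : ¬ (ρ ∈ zetaZeroBox 0 (2 * T + h) ∧ T + h ≤ ρ.im ∧ ρ.im ≤ 2 * T)) :
    T / 8 - 1 ≤ |ρ.im - u| := by
  have h0 := ZetaZeros.riemannZetaNontrivialZeros.re_pos hρ
  have h1 := ZetaZeros.riemannZetaNontrivialZeros.re_lt_one hρ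
  have hz := ZetaZeros.riemannZetaNontrivialZeros.zeta_eq_zero hρ
  by_cases hbox : ρ ∈ zetaZeroBox 0 (2 * T + h)
  · have hγ : ¬ (T + h ≤ ρ.im ∧ ρ.im ≤ 2 * T) := fun h' => hni ⟨hbox, h'⟩
    rw [not_and_or, not_le, not_le] at hγ
    rcases hγ with hγ | hγ
    · rw [abs_of_nonpos (by linarith [hu.1])]; linarith [hu.1]
    · rw [abs_of_nonneg (by linarith [hu.2])]; linarith [hu.2]
  · -- not in the box: `γ ≤ 0` or `γ > 2T + h`
    simp only [zetaZeroBox, Set.mem_setOf_eq, not_and_or, not_le, not_lt] at hbox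
    rcases hbox with hbox | hbox | hbox | hbox | hbox
    · exact absurd hz hbox
    · linarith
    · linarith
    · rw [abs_of_nonpos (by linarith [hu.1])]
      linarith [hu.1]
    · rw [abs_of_nonneg (by linarith [hu.2])]; linarith [hu.2]

open Classical in
/-- **The remainder bound.** There is `C_rem > 0` such that for `T ≥ 200`, `0 ≤ h ≤ 1`, `τ ≥ 1` and
`u ∈ [9T/8, 15T/8]`: the zero side of the integrated explicit formula minus the counting side is
`∑_ρ m(ρ) ∫_u^{u+h} K_τ(γ−t) dt − ∑_{ρ∈box(2T+h)} m(ρ) ∫_T^{2T} K_τ(t−u) 1_{[γ−h,γ)}(t) dt`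
`= O(h (log(|u|+2)+2)/(τ√T))`, and the first series converges absolutely. [cite: Titchmarsh1986, §9.26] -/
theorem exists_remainder_bound : ∃ C : ℝ, 0 < C ∧ ∀ (T h τ u : ℝ), 200 ≤ T → 0 ≤ h → h ≤ 1 → 1 ≤ τ →
    u ∈ Set.Icc (9 * T / 8) (15 * T / 8) →
    Summable (fun ρ : ZetaZeros.riemannZetaNontrivialZeros =>
      (riemannZetaZeroOrder (ρ : ℂ) : ℝ) * ∫ t in u..u + h, kerDil τ ((ρ : ℂ).im - t)) ∧
    |(∑' ρ : ZetaZeros.riemannZetaNontrivialZeros,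
        (riemannZetaZeroOrder (ρ : ℂ) : ℝ) * ∫ t in u..u + h, kerDil τ ((ρ : ℂ).im - t)) -
      ∑ ρ ∈ (zetaZeroBox_finite 0 (2 * T + h)).toFinset, (riemannZetaZeroOrder ρ : ℝ) *
        ∫ t in T..2 * T, kerDil τ (t - u) * Set.indicator (Set.Ico (ρ.im - h) ρ.im) (fun _ => (1 : ℝ)) t| ≤
      C * h * (Real.log (|u| + 2) + 2) / (τ * Real.sqrt T) := by
  obtain ⟨C, hC0, hC⟩ := exists_kerDil_le
  obtain ⟨Cw, hCw0, hCw⟩ := exists_sum_le_of_abs_im_sub_le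
  refine ⟨Cw * (180 * C), by positivity, ?_⟩
  intro T h τ u hT hh hh1 hτ hu
  have hτ0 : 0 < τ := by linarith
  have hT0 : 0 < T := by linarith
  set R := T / 9 with hR
  have hR4 : 4 ≤ R := by rw [hR]; linarith
  set F := (zetaZeroBox_finite 0 (2 * T + h)).toFinset with hF
  -- the three per-zero quantities
  set A : ℂ → ℝ := fun ρ => ∫ t in u..u + h, kerDil τ (ρ.im - t) with hA
  set I : ℂ → ℝ := fun ρ => ∫ t in T..2 * T, kerDil τ (t - u) * Set.indicator (Set.Ico (ρ.im - h) ρ.im) (fun _ => (1 : ℝ)) t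
    with hI
  set J : ℂ → ℝ := fun ρ => if ρ ∈ zetaZeroBox 0 (2 * T + h) then I ρ else 0 with hJ
  set g : ℂ → ℝ := fun ρ => |A ρ - J ρ| with hg
  set ψ : ℤ → ℝ := fun k => (5 * h * C / τ) / (max (|(k : ℝ) - u|) R) ^ 2 with hψ
  have hψ0 : ∀ k, 0 ≤ ψ k := fun k => by rw [hψ]; positivity
  -- Step 1: the majorant
  have hmaj : ∀ ρ ∈ ZetaZeros.riemannZetaNontrivialZeros, g ρ ≤ ψ (round ρ.im) := by
    intro ρ hρ
    by_cases hint : ρ ∈ zetaZeroBox 0 (2 * T + h) ∧ T + h ≤ ρ.im ∧ ρ.im ≤ 2 * T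
    · -- interior: exact cancellation
      have hAI : A ρ = I ρ := by
        simp only [hA, hI]
        rw [interior_term_eq τ u hh (by linarith [hint.2.1]) hint.2.2]
      simp only [hg, hJ, if_pos hint.1, hAI, sub_self, abs_zero]
      exact hψ0 _
    · have hdist := abs_im_sub_ge_of_not_interior (by linarith) hh hh1 hu hρ hint
      have hγ2 : 2 ≤ |ρ.im - u| := by linarith
      have hγR : R ≤ |ρ.im - u| := by rw [hR]; linarith
      have hA' : |A ρ| ≤ h * (C / (τ * (ρ.im - u) ^ 2)) := abs_integral_window_le hC hC0.le hτ0 hh hh1 hγ2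
      have hJ' : |J ρ| ≤ h * (C / (τ * (ρ.im - u) ^ 2)) := by
        simp only [hJ]
        split_ifs
        · exact abs_integral_count_le hC hC0.le hτ0 hh hh1 (by linarith) hγ2
        · rw [abs_zero]; positivity
      have hg1 : g ρ ≤ 2 * (h * (C / (τ * (ρ.im - u) ^ 2))) := by
        simp only [hg]
        have := abs_sub (A ρ) (J ρ); linarith
      refine hg1.trans ?_
      -- compare `(γ − u)²` with `max(|k − u|, R)²`, `k = round γ`
      set k := round ρ.im with hk
      have hkγ : |(k : ℝ) - ρ.im| ≤ 1 / 2 := by have := abs_sub_round ρ.im; rwa [abs_sub_comm]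
      have hmax : max (|(k : ℝ) - u|) R ≤ 3 / 2 * |ρ.im - u| := by
        refine max_le ?_ (by linarith)
        have := abs_sub_le (k : ℝ) ρ.im u
        linarith
      have hne : (ρ.im - u) ^ 2 ≠ 0 := by
        intro h0; rw [sq_eq_zero_iff] at h0; rw [h0, abs_zero] at hγ2; linarith
      have hpos : 0 < (ρ.im - u) ^ 2 := lt_of_le_of_ne (sq_nonneg _) (Ne.symm hne)
      have hmpos : 0 < max (|(k : ℝ) - u|) R := lt_of_lt_of_le (by linarith) (le_max_right _ _)
      simp only [hψ]
      rw [div_div, show 2 * (h * (C / (τ * (ρ.im - u) ^ 2))) = (2 * h * C) / (τ * (ρ.im - u) ^ 2) by ring,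
        div_le_div_iff₀ (by positivity) (by positivity)]
      have hsq : (max (|(k : ℝ) - u|) R) ^ 2 ≤ 9 / 4 * (ρ.im - u) ^ 2 := by
        rw [← sq_abs (ρ.im - u)]
        nlinarith [hmpos.le, abs_nonneg (ρ.im - u)]
      have h5 : 0 ≤ h * C * τ := by positivity
      nlinarith [mul_le_mul_of_nonneg_left hsq h5]
  -- Step 2: the `Ψ` bound
  have hΨ : ∀ K : Finset ℤ, ∑ k ∈ K, ψ k * Real.log (|(k : ℝ)| + 2) ≤
      180 * C * h * (Real.log (|u| + 2) + 2) / (τ * Real.sqrt T) := by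
    intro K
    have hs := sum_log_div_max_sq_le K u hR4
    have heq : ∑ k ∈ K, ψ k * Real.log (|(k : ℝ)| + 2) =
        (5 * h * C / τ) * ∑ k ∈ K, Real.log (|(k : ℝ)| + 2) / (max (|(k : ℝ) - u|) R) ^ 2 := by
      rw [Finset.mul_sum]; refine Finset.sum_congr rfl fun k _ => ?_; simp only [hψ]; ring
    rw [heq]
    have hsqrt : Real.sqrt R = Real.sqrt T / 3 := by
      rw [hR, Real.sqrt_div' T (by norm_num : (0:ℝ) ≤ 9),
        show Real.sqrt (9 : ℝ) = 3 by rw [show (9 : ℝ) = 3 ^ 2 by norm_num]; exact Real.sqrt_sq (by norm_num)]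
    calc (5 * h * C / τ) * ∑ k ∈ K, Real.log (|(k : ℝ)| + 2) / (max (|(k : ℝ) - u|) R) ^ 2
        ≤ (5 * h * C / τ) * (12 * (Real.log (|u| + 2) + 2) / Real.sqrt R) :=
          mul_le_mul_of_nonneg_left hs (by positivity)
      _ = 180 * C * h * (Real.log (|u| + 2) + 2) / (τ * Real.sqrt T) := by
          rw [hsqrt]; field_simp; ring
  -- Step 3: summability and the bound for `∑ m g`
  have hg0 : ∀ ρ ∈ ZetaZeros.riemannZetaNontrivialZeros, 0 ≤ g ρ := fun ρ _ => abs_nonneg _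
  obtain ⟨hsum_g, hle_g⟩ := tsum_mul_le_of_ordinate_majorant hCw0.le hCw hψ0 hg0 hmaj hΨ
  -- Step 4: `J` has finite support; `∑' m J = ∑_F m I`
  set F' : Finset ZetaZeros.riemannZetaNontrivialZeros := F.subtype (· ∈ ZetaZeros.riemannZetaNontrivialZeros) with hF'
  have hJzero : ∀ ρ : ZetaZeros.riemannZetaNontrivialZeros, ρ ∉ F' →
      (riemannZetaZeroOrder (ρ : ℂ) : ℝ) * J ρ = 0 := by
    intro ρ hρ
    rw [hF', Finset.mem_subtype, hF, Set.Finite.mem_toFinset] at hρ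
    simp only [hJ, if_neg hρ, mul_zero]
  have hsumJ : Summable fun ρ : ZetaZeros.riemannZetaNontrivialZeros => (riemannZetaZeroOrder (ρ : ℂ) : ℝ) * J ρ :=
    summable_of_ne_finset_zero hJzero
  have htsumJ : ∑' ρ : ZetaZeros.riemannZetaNontrivialZeros, (riemannZetaZeroOrder (ρ : ℂ) : ℝ) * J ρ =
      ∑ ρ ∈ F, (riemannZetaZeroOrder ρ : ℝ) * I ρ := by
    rw [tsum_eq_sum hJzero, hF',
      Finset.sum_subtype_eq_sum_filter (f := fun x : ℂ => (riemannZetaZeroOrder x : ℝ) * J x)]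
    have hfil : F.filter (· ∈ ZetaZeros.riemannZetaNontrivialZeros) = F := by
      refine Finset.filter_true_of_mem fun ρ hρ => ?_
      rw [hF, Set.Finite.mem_toFinset] at hρ
      exact ZetaZeros.riemannZetaNontrivialZeros.mem_of_im_ne_zero hρ.1 hρ.2.2.2.1.ne'
    rw [hfil]
    refine Finset.sum_congr rfl fun ρ hρ => ?_
    rw [hF, Set.Finite.mem_toFinset] at hρ
    simp only [hJ, if_pos hρ]
  -- summability of `m A`: `m A = m (A − J) + m J`, `|m (A − J)| = m g`
  have hsumAJ : Summable fun ρ : ZetaZeros.riemannZetaNontrivialZeros =>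
      (riemannZetaZeroOrder (ρ : ℂ) : ℝ) * (A ρ - J ρ) := by
    refine Summable.of_norm ?_
    refine hsum_g.congr fun ρ => ?_
    have hm : (0 : ℝ) ≤ riemannZetaZeroOrder (ρ : ℂ) :=
      riemannZetaZeroOrder_nonneg_of_zero (ZetaZeros.riemannZetaNontrivialZeros.zeta_eq_zero ρ.2)
    simp only [hg, Real.norm_eq_abs, abs_mul, abs_of_nonneg hm]
  have hsumA : Summable fun ρ : ZetaZeros.riemannZetaNontrivialZeros => (riemannZetaZeroOrder (ρ : ℂ) : ℝ) * A ρ := by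
    have := hsumAJ.add hsumJ
    refine this.congr fun ρ => ?_
    ring
  refine ⟨hsumA, ?_⟩
  -- the difference
  have hdiff : (∑' ρ : ZetaZeros.riemannZetaNontrivialZeros, (riemannZetaZeroOrder (ρ : ℂ) : ℝ) * A ρ) -
      ∑ ρ ∈ F, (riemannZetaZeroOrder ρ : ℝ) * I ρ =
      ∑' ρ : ZetaZeros.riemannZetaNontrivialZeros, (riemannZetaZeroOrder (ρ : ℂ) : ℝ) * (A ρ - J ρ) := by
    rw [← htsumJ, ← hsumA.tsum_sub hsumJ]
    refine tsum_congr fun ρ => by ring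
  rw [hdiff]
  calc |∑' ρ : ZetaZeros.riemannZetaNontrivialZeros, (riemannZetaZeroOrder (ρ : ℂ) : ℝ) * (A ρ - J ρ)|
      ≤ ∑' ρ : ZetaZeros.riemannZetaNontrivialZeros, |(riemannZetaZeroOrder (ρ : ℂ) : ℝ) * (A ρ - J ρ)| := by
        have := norm_tsum_le_tsum_norm hsumAJ.norm
        simpa only [Real.norm_eq_abs] using this
    _ = ∑' ρ : ZetaZeros.riemannZetaNontrivialZeros, (riemannZetaZeroOrder (ρ : ℂ) : ℝ) * g ρ := by
        refine tsum_congr fun ρ => ?_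
        have hm : (0 : ℝ) ≤ riemannZetaZeroOrder (ρ : ℂ) :=
          riemannZetaZeroOrder_nonneg_of_zero (ZetaZeros.riemannZetaNontrivialZeros.zeta_eq_zero ρ.2)
        simp only [hg, abs_mul, abs_of_nonneg hm]
    _ ≤ Cw * (180 * C * h * (Real.log (|u| + 2) + 2) / (τ * Real.sqrt T)) := hle_g
    _ = Cw * (180 * C) * h * (Real.log (|u| + 2) + 2) / (τ * Real.sqrt T) := by ring

/-! ### The archimedean side: `∫_u^{u+h} (K_τ ⋆ θ')(t) dt = ∫ K_τ(v − u) (θ(v+h) − θ(v)) dv` -/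

/-- Shift: `∫ K_τ(v − t) θ'(v) dv = ∫ K_τ(w − u) θ'(w + (t − u)) dw`. [folklore] -/
theorem integral_kerDil_thetaDeriv_shift (τ u t : ℝ) :
    ∫ v : ℝ, kerDil τ (v - t) * riemannSiegelThetaDeriv v =
      ∫ w : ℝ, kerDil τ (w - u) * riemannSiegelThetaDeriv (w + (t - u)) := by
  rw [← integral_add_right_eq_self (fun v => kerDil τ (v - t) * riemannSiegelThetaDeriv v) (t - u)]
  refine integral_congr_ae (ae_of_all _ fun w => ?_)
  simp only
  congr 2; ring

/-- A majorant for `K_τ(w − u) θ'(w + s)`, `|s| ≤ 1`: with `|θ'(x)| ≤ C_θ (1 + |x|)`,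
`|K_τ(w−u) θ'(w+s)| ≤ C_θ (2 + |u|) K_τ(w−u) + C_θ K_τ(w−u) |w − u|`. [folklore] -/
theorem abs_kerDil_mul_thetaDeriv_le {Cθ : ℝ} (hC0 : 0 ≤ Cθ) (hCθ : ∀ x : ℝ, |riemannSiegelThetaDeriv x| ≤ Cθ * (1 + |x|))
    {τ : ℝ} (hτ : 0 ≤ τ) (u w s : ℝ) (hs : |s| ≤ 1) :
    |kerDil τ (w - u) * riemannSiegelThetaDeriv (w + s)| ≤
      Cθ * (2 + |u|) * kerDil τ (w - u) + Cθ * (kerDil τ (w - u) * |w - u|) := by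
  have hK := kerDil_nonneg hτ (w - u)
  rw [abs_mul, abs_of_nonneg hK]
  have h1 := hCθ (w + s)
  have h2 : |w + s| ≤ |w - u| + |u| + 1 := by
    have := abs_add_le (w - u) (u + s); have := abs_add_le u s
    rw [show w - u + (u + s) = w + s by ring] at *; linarith
  calc kerDil τ (w - u) * |riemannSiegelThetaDeriv (w + s)| ≤ kerDil τ (w - u) * (Cθ * (1 + |w + s|)) :=
        mul_le_mul_of_nonneg_left h1 hK
    _ ≤ kerDil τ (w - u) * (Cθ * (2 + |u| + |w - u|)) := by
        refine mul_le_mul_of_nonneg_left (mul_le_mul_of_nonneg_left (by linarith) hC0) hK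
    _ = _ := by ring

/-- `w ↦ K_τ(w − u) |w − u|` is integrable (`τ ≥ 1`). [folklore] -/
theorem integrable_kerDil_mul_abs {τ : ℝ} (hτ : 1 ≤ τ) (u : ℝ) :
    Integrable fun w : ℝ => kerDil τ (w - u) * |w - u| := by
  obtain ⟨C, hC0, hC⟩ := exists_kerDil_le
  have h0 : Integrable fun w : ℝ => C / 2 * (1 + (w - u) ^ 2)⁻¹ :=
    (integrable_inv_one_add_sq.comp_sub_right u).const_mul (C / 2)
  refine h0.mono' ?_ (ae_of_all _ fun w => ?_)
  · exact (((continuous_kerDil τ).comp (continuous_id.sub continuous_const)).mul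
      (continuous_id.sub continuous_const).abs).aestronglyMeasurable
  · have hK := kerDil_nonneg (by linarith : (0:ℝ) ≤ τ) (w - u)
    rw [Real.norm_eq_abs, abs_of_nonneg (mul_nonneg hK (abs_nonneg _))]
    have h1 := hC τ (by linarith) (w - u)
    set r := w - u with hr
    -- `K |r| ≤ τ C |r|/(1+τ²r²)² ≤ (C/2) /(1 + r²)`
    have hτr : τ * |r| ≤ (1 + (τ * r) ^ 2) / 2 := by
      rw [mul_pow, ← sq_abs r]; nlinarith [sq_nonneg (τ * |r| - 1), abs_nonneg r]
    have hden : 1 + r ^ 2 ≤ 1 + (τ * r) ^ 2 := by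
      rw [mul_pow]; nlinarith [sq_nonneg r, show 1 ≤ τ ^ 2 by nlinarith]
    have hpos : 0 < 1 + (τ * r) ^ 2 := by positivity
    have hpos2 : 0 < 1 + r ^ 2 := by positivity
    calc kerDil τ r * |r| ≤ τ * C / (1 + (τ * r) ^ 2) ^ 2 * |r| := mul_le_mul_of_nonneg_right h1 (abs_nonneg _)
      _ = C * (τ * |r|) / (1 + (τ * r) ^ 2) ^ 2 := by ring
      _ ≤ C * ((1 + (τ * r) ^ 2) / 2) / (1 + (τ * r) ^ 2) ^ 2 := by gcongr
      _ = C / 2 * (1 + (τ * r) ^ 2)⁻¹ := by field_simp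
      _ ≤ C / 2 * (1 + r ^ 2)⁻¹ := by
          refine mul_le_mul_of_nonneg_left ?_ (by linarith)
          exact inv_anti₀ hpos2 hden

/-- **The archimedean side of the integrated explicit formula is the smoothed increment of `θ`**:
`∫_u^{u+h} ∫ K_τ(v − t) θ'(v) dv dt = ∫ K_τ(w − u) (θ(w + h) − θ(w)) dw` (`τ ≥ 1`, `0 ≤ h ≤ 1`).
[folklore] -/
theorem integral_integral_kerDil_thetaDeriv_eq {τ : ℝ} (hτ : 1 ≤ τ) (u : ℝ) {h : ℝ} (hh : 0 ≤ h) (hh1 : h ≤ 1) :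
    ∫ t in u..u + h, (∫ v : ℝ, kerDil τ (v - t) * riemannSiegelThetaDeriv v) =
      ∫ w : ℝ, kerDil τ (w - u) * (riemannSiegelTheta (w + h) - riemannSiegelTheta w) := by
  obtain ⟨Cθ, hCθ0, hCθ⟩ := exists_abs_riemannSiegelThetaDeriv_le
  have hτ0 : (0 : ℝ) ≤ τ := by linarith
  simp_rw [integral_kerDil_thetaDeriv_shift τ u]
  -- Fubini on `(u, u+h] × ℝ`
  set Fn : ℝ → ℝ → ℝ := fun t w => kerDil τ (w - u) * riemannSiegelThetaDeriv (w + (t - u)) with hFn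
  have hcont : Continuous (Function.uncurry Fn) := by
    simp only [hFn]
    exact ((continuous_kerDil τ).comp (continuous_snd.sub continuous_const)).mul
      (continuous_thetaDeriv.comp (continuous_snd.add (continuous_fst.sub continuous_const)))
  set G : ℝ → ℝ := fun w => Cθ * (2 + |u|) * kerDil τ (w - u) + Cθ * (kerDil τ (w - u) * |w - u|) with hG
  have hGint : Integrable G :=
    (((integrable_kerDil (by linarith)).comp_sub_right u).const_mul _).add ((integrable_kerDil_mul_abs hτ u).const_mul _)
  have hprod : Integrable (Function.uncurry Fn) ((volume.restrict (Set.Ioc u (u + h))).prod volume) := by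
    have h1 : Integrable (fun _ : ℝ => (1 : ℝ)) (volume.restrict (Set.Ioc u (u + h))) :=
      ((continuous_const (y := (1 : ℝ))).integrableOn_Icc (a := u) (b := u + h)).mono_set Set.Ioc_subset_Icc_self
    refine (h1.mul_prod hGint).mono' hcont.aestronglyMeasurable ?_
    have hmem : ∀ᵐ p : ℝ × ℝ ∂((volume.restrict (Set.Ioc u (u + h))).prod volume), p ∈ Set.Ioc u (u + h) ×ˢ (Set.univ : Set ℝ) := by
      have e : (volume.restrict (Set.Ioc u (u + h))).prod (volume : Measure ℝ) =
          ((volume : Measure ℝ).prod (volume : Measure ℝ)).restrict (Set.Ioc u (u + h) ×ˢ Set.univ) := by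
        conv_lhs => rw [← Measure.restrict_univ (μ := (volume : Measure ℝ))]
        rw [Measure.prod_restrict, Measure.restrict_univ]
      rw [e]
      exact ae_restrict_mem (measurableSet_Ioc.prod MeasurableSet.univ)
    filter_upwards [hmem] with p hp
    rw [Set.mem_prod] at hp
    have ht : |p.1 - u| ≤ 1 := by rw [abs_of_nonneg (by linarith [hp.1.1])]; linarith [hp.1.2]
    have := abs_kerDil_mul_thetaDeriv_le hCθ0.le hCθ hτ0 u p.2 (p.1 - u) ht
    simp only [hFn, hG, Real.norm_eq_abs, one_mul]
    exact this
  have hswap := MeasureTheory.integral_integral_swap hprod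
  rw [intervalIntegral.integral_of_le (by linarith)]
  simp only [hFn] at hswap
  rw [hswap]
  refine integral_congr_ae (ae_of_all _ fun w => ?_)
  simp only
  rw [MeasureTheory.integral_const_mul, ← intervalIntegral.integral_of_le (by linarith)]
  congr 1
  -- FTC in `t`
  have hderiv : ∀ t ∈ Set.uIcc u (u + h), HasDerivAt (fun t : ℝ => riemannSiegelTheta (w + (t - u)))
      (riemannSiegelThetaDeriv (w + (t - u))) t := by
    intro t _
    have h1 := hasDerivAt_riemannSiegelTheta_holds (w + (t - u))
    have h2 : HasDerivAt (fun t : ℝ => w + (t - u)) 1 t := by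
      simpa using ((hasDerivAt_id t).sub_const u).const_add w
    have h3 : HasDerivAt (riemannSiegelTheta ∘ fun t : ℝ => w + (t - u))
        (riemannSiegelThetaDeriv (w + (t - u)) * 1) t := h1.comp t h2
    rw [mul_one] at h3
    exact h3
  have hint : IntervalIntegrable (fun t : ℝ => riemannSiegelThetaDeriv (w + (t - u))) volume u (u + h) :=
    (continuous_thetaDeriv.comp (by fun_prop)).intervalIntegrable _ _
  rw [intervalIntegral.integral_eq_sub_of_hasDerivAt hderiv hint]
  simp

/-! ### The `θ`-tails outside `[T, 2T]` -/

/-- `|θ(w + h) − θ(w)| ≤ h C_θ (2 + |w|)` for `0 ≤ h ≤ 1`. [folklore] -/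
theorem abs_deltaTheta_le {Cθ : ℝ} (hC0 : 0 ≤ Cθ) (hCθ : ∀ x : ℝ, |riemannSiegelThetaDeriv x| ≤ Cθ * (1 + |x|))
    {h : ℝ} (hh : 0 ≤ h) (hh1 : h ≤ 1) (w : ℝ) :
    |riemannSiegelTheta (w + h) - riemannSiegelTheta w| ≤ h * (Cθ * (2 + |w|)) := by
  have hderiv : ∀ t ∈ Set.uIcc w (w + h), HasDerivAt riemannSiegelTheta (riemannSiegelThetaDeriv t) t :=
    fun t _ => hasDerivAt_riemannSiegelTheta_holds t
  have hint : IntervalIntegrable riemannSiegelThetaDeriv volume w (w + h) :=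
    continuous_thetaDeriv.intervalIntegrable _ _
  rw [← intervalIntegral.integral_eq_sub_of_hasDerivAt hderiv hint]
  have hb : ∀ t ∈ Set.uIoc w (w + h), ‖riemannSiegelThetaDeriv t‖ ≤ Cθ * (2 + |w|) := by
    intro t ht
    rw [Set.uIoc_of_le (by linarith)] at ht
    rw [Real.norm_eq_abs]
    refine (hCθ t).trans (mul_le_mul_of_nonneg_left ?_ hC0)
    have : |t| ≤ |w| + 1 := by
      have := abs_add_le w (t - w); rw [add_sub_cancel] at this
      have h2 : |t - w| ≤ 1 := by rw [abs_of_nonneg (by linarith [ht.1])]; linarith [ht.2]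
      linarith
    linarith
  have := intervalIntegral.norm_integral_le_of_norm_le_const hb
  rw [Real.norm_eq_abs, show |w + h - w| = h by rw [add_sub_cancel_left, abs_of_nonneg hh]] at this
  linarith

/-- `∫ dw/((w − u)² + R²) = π/R` (`R > 0`). [folklore] -/
theorem integral_inv_sq_add_sq (u : ℝ) {R : ℝ} (hR : 0 < R) : ∫ w : ℝ, 1 / ((w - u) ^ 2 + R ^ 2) = π / R := by
  have h1 : ∫ w : ℝ, 1 / ((w - u) ^ 2 + R ^ 2) = ∫ x : ℝ, 1 / (x ^ 2 + R ^ 2) := by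
    rw [← integral_sub_right_eq_self (fun x : ℝ => 1 / (x ^ 2 + R ^ 2)) u]
  rw [h1]
  have h2 := MeasureTheory.Measure.integral_comp_mul_left (fun y : ℝ => 1 / ((R * y) ^ 2 + R ^ 2)) R⁻¹
  rw [inv_inv, abs_of_pos hR] at h2
  have e : (fun x : ℝ => 1 / (x ^ 2 + R ^ 2)) = fun x => (fun y : ℝ => 1 / ((R * y) ^ 2 + R ^ 2)) (R⁻¹ * x) := by
    funext x; simp only; rw [← mul_assoc, mul_inv_cancel₀ hR.ne', one_mul]
  rw [e, h2]
  have e2 : ∀ y : ℝ, 1 / ((R * y) ^ 2 + R ^ 2) = (R ^ 2)⁻¹ * (1 + y ^ 2)⁻¹ := by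
    intro y; rw [mul_pow]; field_simp; ring
  simp_rw [e2, MeasureTheory.integral_const_mul, integral_univ_inv_one_add_sq, smul_eq_mul]
  field_simp

set_option maxHeartbeats 400000 in
/-- **The `θ`-tails**: with `|θ'(x)| ≤ C_θ(1+|x|)` and `K_L(r) ≤ LC/(1+(Lr)²)²`, for `T ≥ 200`,
`0 ≤ h ≤ 1`, `τ ≥ 1`, `u ∈ [9T/8, 15T/8]`,
`|∫ K_τ(w−u) Δθ(w) dw − ∫_T^{2T} K_τ(t−u) Δθ(t) dt| ≤ 27040 h C_θ C/(τ³ T²)`. [folklore] -/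
theorem theta_tail_bound {Cθ C : ℝ} (hCθ0 : 0 ≤ Cθ) (hCθ : ∀ x : ℝ, |riemannSiegelThetaDeriv x| ≤ Cθ * (1 + |x|))
    (hC : ∀ L : ℝ, 0 ≤ L → ∀ r : ℝ, kerDil L r ≤ L * C / (1 + (L * r) ^ 2) ^ 2) (hC0 : 0 ≤ C)
    {T h τ u : ℝ} (hT : 200 ≤ T) (hh : 0 ≤ h) (hh1 : h ≤ 1) (hτ : 1 ≤ τ) (hu : u ∈ Set.Icc (9 * T / 8) (15 * T / 8)) :
    |(∫ w : ℝ, kerDil τ (w - u) * (riemannSiegelTheta (w + h) - riemannSiegelTheta w)) -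
      ∫ t in T..2 * T, kerDil τ (t - u) * (riemannSiegelTheta (t + h) - riemannSiegelTheta t)| ≤
      27040 * h * Cθ * C / (τ ^ 3 * T ^ 2) := by
  have hτ0 : 0 < τ := by linarith
  have hT0 : 0 < T := by linarith
  set R := T / 8 with hR
  have hR1 : 1 ≤ R := by rw [hR]; linarith
  have hR0 : 0 < R := by linarith
  set f : ℝ → ℝ := fun w => kerDil τ (w - u) * (riemannSiegelTheta (w + h) - riemannSiegelTheta w) with hf
  have hθc : Continuous riemannSiegelTheta :=
    continuous_iff_continuousAt.2 fun t => (hasDerivAt_riemannSiegelTheta_holds t).continuousAt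
  have hfc : Continuous f := ((continuous_kerDil τ).comp (continuous_id.sub continuous_const)).mul
    ((hθc.comp (continuous_id.add continuous_const)).sub hθc)
  -- integrability of `f` on `ℝ`
  have hfint : Integrable f := by
    have hG : Integrable fun w : ℝ => h * Cθ * (2 + |u|) * kerDil τ (w - u) + h * Cθ * (kerDil τ (w - u) * |w - u|) :=
      (((integrable_kerDil hτ0).comp_sub_right u).const_mul _).add ((integrable_kerDil_mul_abs hτ u).const_mul _)
    refine hG.mono' hfc.aestronglyMeasurable (ae_of_all _ fun w => ?_)
    have hK := kerDil_nonneg hτ0.le (w - u)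
    simp only [hf, Real.norm_eq_abs, abs_mul, abs_of_nonneg hK]
    have h1 := abs_deltaTheta_le hCθ0 hCθ hh hh1 w
    have h2 : |w| ≤ |u| + |w - u| := by have := abs_add_le u (w - u); rwa [add_sub_cancel] at this
    calc kerDil τ (w - u) * |riemannSiegelTheta (w + h) - riemannSiegelTheta w| ≤ kerDil τ (w - u) * (h * (Cθ * (2 + |w|))) :=
          mul_le_mul_of_nonneg_left h1 hK
      _ ≤ kerDil τ (w - u) * (h * (Cθ * (2 + |u| + |w - u|))) :=
          mul_le_mul_of_nonneg_left (mul_le_mul_of_nonneg_left (mul_le_mul_of_nonneg_left (by linarith) hCθ0) hh) hK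
      _ = _ := by ring
  -- split `∫_ℝ = ∫_{(T,2T]} + ∫_{complement}`
  have hsplit := MeasureTheory.integral_add_compl (measurableSet_Ioc (a := T) (b := 2 * T)) hfint
  have hIoc : ∫ w in Set.Ioc T (2 * T), f w = ∫ t in T..2 * T, f t := (intervalIntegral.integral_of_le (by linarith)).symm
  rw [← hsplit, hIoc, add_sub_cancel_left]
  -- majorant on the complement
  set M : ℝ → ℝ := fun w => h * Cθ * C / τ ^ 3 * (4 * (2 + |u|) / R ^ 2 + 2 / R) * (1 / ((w - u) ^ 2 + R ^ 2)) with hM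
  have hMint : Integrable M := by
    have h0 : Integrable fun w : ℝ => (1 + (w - u) ^ 2)⁻¹ := integrable_inv_one_add_sq.comp_sub_right u
    have h1 : Integrable fun w : ℝ => 1 / ((w - u) ^ 2 + R ^ 2) := by
      refine h0.mono' (continuous_const.div (by fun_prop) fun w => by positivity).aestronglyMeasurable
        (ae_of_all _ fun w => ?_)
      rw [Real.norm_eq_abs, abs_of_nonneg (by positivity), one_div]
      exact inv_anti₀ (by positivity) (by nlinarith)
    exact h1.const_mul _
  have hbound : ∀ w ∈ (Set.Ioc T (2 * T))ᶜ, |f w| ≤ M w := by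
    intro w hw
    rw [Set.mem_compl_iff, Set.mem_Ioc, not_and_or, not_lt, not_le] at hw
    have hdist : R ≤ |w - u| := by
      rcases hw with hw | hw
      · rw [abs_of_nonpos (by linarith [hu.1])]; rw [hR]; linarith [hu.1]
      · rw [abs_of_nonneg (by linarith [hu.2])]; rw [hR]; linarith [hu.2]
    have hx0 : w - u ≠ 0 := by intro h0; rw [h0, abs_zero] at hdist; linarith
    have hK := kerDil_nonneg hτ0.le (w - u)
    have hKle : kerDil τ (w - u) ≤ C / (τ ^ 3 * (w - u) ^ 4) := by
      refine (hC τ hτ0.le (w - u)).trans ?_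
      have hp : 0 < (w - u) ^ 2 := sq_pos_iff.2 hx0
      rw [div_le_div_iff₀ (by positivity) (by positivity)]
      have : τ ^ 4 * (w - u) ^ 4 ≤ (1 + (τ * (w - u)) ^ 2) ^ 2 := by
        have : (τ * (w - u)) ^ 2 ≤ 1 + (τ * (w - u)) ^ 2 := by linarith
        calc τ ^ 4 * (w - u) ^ 4 = ((τ * (w - u)) ^ 2) ^ 2 := by ring
          _ ≤ (1 + (τ * (w - u)) ^ 2) ^ 2 := pow_le_pow_left₀ (by positivity) this 2
      calc τ * C * (τ ^ 3 * (w - u) ^ 4) = C * (τ ^ 4 * (w - u) ^ 4) := by ring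
        _ ≤ C * (1 + (τ * (w - u)) ^ 2) ^ 2 := mul_le_mul_of_nonneg_left this hC0
    have h1 := abs_deltaTheta_le hCθ0 hCθ hh hh1 w
    have h2 : |w| ≤ |u| + |w - u| := by have := abs_add_le u (w - u); rwa [add_sub_cancel] at this
    simp only [hf, hM, abs_mul, abs_of_nonneg hK]
    -- `|f| ≤ C/(τ³ x⁴) · h Cθ (2 + |u| + |x|)`, `x = w − u`, `|x| ≥ R`
    set x := w - u with hx
    have hax : R ≤ |x| := hdist
    have hx2 : R ^ 2 ≤ x ^ 2 := by rw [← sq_abs x]; exact pow_le_pow_left₀ hR0.le hax 2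
    have hxR : (x ^ 2 + R ^ 2) ≤ 2 * x ^ 2 := by linarith
    have hx4 : 0 < x ^ 4 := by positivity
    have step : kerDil τ x * |riemannSiegelTheta (w + h) - riemannSiegelTheta w| ≤
        C / (τ ^ 3 * x ^ 4) * (h * (Cθ * (2 + |u| + |x|))) := by
      calc kerDil τ x * |riemannSiegelTheta (w + h) - riemannSiegelTheta w| ≤ kerDil τ x * (h * (Cθ * (2 + |w|))) :=
            mul_le_mul_of_nonneg_left h1 hK
        _ ≤ C / (τ ^ 3 * x ^ 4) * (h * (Cθ * (2 + |u| + |x|))) := by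
            refine mul_le_mul hKle ?_ (by positivity) (by positivity)
            exact mul_le_mul_of_nonneg_left (mul_le_mul_of_nonneg_left (by linarith) hCθ0) hh
    refine step.trans ?_
    -- `(2+|u|+|x|)/x⁴ ≤ (4(2+|u|)/R² + 2/R)/(x² + R²)`
    have hkey : (2 + |u| + |x|) / x ^ 4 ≤ (4 * (2 + |u|) / R ^ 2 + 2 / R) * (1 / (x ^ 2 + R ^ 2)) := by
      rw [div_le_iff₀ hx4, show (4 * (2 + |u|) / R ^ 2 + 2 / R) * (1 / (x ^ 2 + R ^ 2)) * x ^ 4 =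
        (4 * (2 + |u|) / R ^ 2 + 2 / R) * x ^ 4 / (x ^ 2 + R ^ 2) by ring, le_div_iff₀ (by positivity)]
      -- `(2+|u|+|x|)(x²+R²) ≤ (4(2+|u|)/R² + 2/R) x⁴`
      have ha : (2 + |u|) * (x ^ 2 + R ^ 2) ≤ (4 * (2 + |u|) / R ^ 2) * x ^ 4 := by
        rw [div_mul_eq_mul_div, le_div_iff₀ (by positivity)]
        have : (x ^ 2 + R ^ 2) * R ^ 2 ≤ 4 * x ^ 4 := by nlinarith
        nlinarith [abs_nonneg u]
      have hb : |x| * (x ^ 2 + R ^ 2) ≤ (2 / R) * x ^ 4 := by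
        rw [div_mul_eq_mul_div, le_div_iff₀ hR0]
        have hx3 : |x| * R ≤ x ^ 2 := by rw [← sq_abs x]; nlinarith [abs_nonneg x]
        nlinarith [abs_nonneg x, sq_nonneg x]
      calc (2 + |u| + |x|) * (x ^ 2 + R ^ 2) = (2 + |u|) * (x ^ 2 + R ^ 2) + |x| * (x ^ 2 + R ^ 2) := by ring
        _ ≤ (4 * (2 + |u|) / R ^ 2) * x ^ 4 + (2 / R) * x ^ 4 := add_le_add ha hb
        _ = _ := by ring
    have hfac : 0 ≤ C / τ ^ 3 * (h * Cθ) := by positivity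
    calc C / (τ ^ 3 * x ^ 4) * (h * (Cθ * (2 + |u| + |x|))) = C / τ ^ 3 * (h * Cθ) * ((2 + |u| + |x|) / x ^ 4) := by
          field_simp
      _ ≤ C / τ ^ 3 * (h * Cθ) * ((4 * (2 + |u|) / R ^ 2 + 2 / R) * (1 / (x ^ 2 + R ^ 2))) :=
          mul_le_mul_of_nonneg_left hkey hfac
      _ = _ := by ring
  -- integrate the majorant
  calc |∫ w in (Set.Ioc T (2 * T))ᶜ, f w| ≤ ∫ w in (Set.Ioc T (2 * T))ᶜ, |f w| := by
        have := norm_integral_le_integral_norm (μ := volume.restrict (Set.Ioc T (2 * T))ᶜ) f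
        simpa only [Real.norm_eq_abs] using this
    _ ≤ ∫ w in (Set.Ioc T (2 * T))ᶜ, M w := by
        refine setIntegral_mono_on hfint.norm.integrableOn hMint.integrableOn (measurableSet_Ioc.compl) fun w hw => ?_
        exact hbound w hw
    _ ≤ ∫ w, M w := setIntegral_le_integral hMint (ae_of_all _ fun w => by simp only [hM]; positivity)
    _ = h * Cθ * C / τ ^ 3 * (4 * (2 + |u|) / R ^ 2 + 2 / R) * (π / R) := by
        simp only [hM]; rw [MeasureTheory.integral_const_mul, integral_inv_sq_add_sq u hR0]
    _ ≤ 27040 * h * Cθ * C / (τ ^ 3 * T ^ 2) := by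
        -- numerics: `|u| ≤ 2T`, `R = T/8`, `π ≤ 3.25`
        have hu2 : |u| ≤ 2 * T := by rw [abs_of_nonneg (by linarith [hu.1])]; linarith [hu.2]
        have hb1 : 4 * (2 + |u|) / R ^ 2 + 2 / R ≤ 1040 / T := by
          rw [hR]
          have e1 : 4 * (2 + |u|) / (T / 8) ^ 2 = 256 * (2 + |u|) / T ^ 2 := by field_simp; ring
          have e2 : 2 / (T / 8) = 16 / T := by field_simp; ring
          rw [e1, e2, div_add_div _ _ (by positivity) (by positivity), div_le_div_iff₀ (by positivity) hT0]
          nlinarith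
        have hb2 : π / R ≤ 26 / T := by
          rw [hR, div_le_div_iff₀ (by positivity) hT0]; nlinarith [Real.pi_lt_d2]
        have hfac : 0 ≤ h * Cθ * C / τ ^ 3 := by positivity
        calc h * Cθ * C / τ ^ 3 * (4 * (2 + |u|) / R ^ 2 + 2 / R) * (π / R)
            ≤ h * Cθ * C / τ ^ 3 * (1040 / T) * (26 / T) := by
              refine mul_le_mul (mul_le_mul_of_nonneg_left hb1 hfac) hb2 (by positivity) (by positivity)
          _ = 27040 * h * Cθ * C / (τ ^ 3 * T ^ 2) := by field_simp; ring

/-! ### Young's inequality in the direction `‖K_τ ⋆_T f‖_{L¹(W)} ≤ (∫ K_τ) ‖f‖_{L¹[T,2T]}` -/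

/-- Continuity in `u` of `∫_T^{2T} K_τ(t − u) f(t) dt` for `f` integrable on `[T, 2T]`. [folklore] -/
theorem continuous_conv {τ : ℝ} (hτ : 0 < τ) {f : ℝ → ℝ} {T : ℝ}
    (hf : IntervalIntegrable f volume T (2 * T)) :
    Continuous fun u : ℝ => ∫ t in T..2 * T, kerDil τ (t - u) * f t := by
  obtain ⟨C, hC0, hC⟩ := exists_kerDil_le
  have hKbd : ∀ r : ℝ, kerDil τ r ≤ τ * C := fun r => (hC τ hτ.le r).trans (by
    apply div_le_self (by positivity); exact one_le_pow₀ (by nlinarith [sq_nonneg (τ * r)]))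
  have hKnn : ∀ r : ℝ, 0 ≤ kerDil τ r := fun r => kerDil_nonneg hτ.le r
  have hfm : AEStronglyMeasurable f (volume.restrict (Set.uIoc T (2 * T))) := hf.def'.aestronglyMeasurable
  refine intervalIntegral.continuous_of_dominated_interval (bound := fun t => τ * C * |f t|) ?_ ?_ ?_ ?_
  · intro u
    exact (((continuous_kerDil τ).comp (continuous_id.sub continuous_const)).aestronglyMeasurable).mul hfm
  · intro u
    refine ae_of_all _ fun t _ => ?_
    rw [Real.norm_eq_abs, abs_mul, abs_of_nonneg (hKnn _)]
    exact mul_le_mul_of_nonneg_right (hKbd _) (abs_nonneg _)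
  · exact hf.norm.const_mul _
  · refine ae_of_all _ fun t _ => ?_
    exact ((continuous_kerDil τ).comp (continuous_const.sub continuous_id)).mul continuous_const

/-- **Young's inequality, `L¹ → L¹`**: for `f` interval integrable on `[T, 2T]` (`0 ≤ T`), `a ≤ b`,
`τ > 0`: `∫_a^b |∫_T^{2T} K_τ(t−u) f(t) dt| du ≤ 2π Re g₀(0) · ∫_T^{2T} |f(t)| dt` (`∫ K_τ = 2π g₀(0)`,
`K_τ ≥ 0`). [folklore] -/
theorem integral_abs_conv_le {τ : ℝ} (hτ : 0 < τ) {f : ℝ → ℝ} {T : ℝ} (hT : 0 ≤ T)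
    (hf : IntervalIntegrable f volume T (2 * T)) {a b : ℝ} (hab : a ≤ b) :
    ∫ u in a..b, |∫ t in T..2 * T, kerDil τ (t - u) * f t| ≤
      (2 * π * (RudnickSarnakN.g0 0).re) * ∫ t in T..2 * T, |f t| := by
  obtain ⟨C, hC0, hC⟩ := exists_kerDil_le
  have hT2 : T ≤ 2 * T := by linarith
  have hKbd : ∀ r : ℝ, kerDil τ r ≤ τ * C := fun r => (hC τ hτ.le r).trans (by
    apply div_le_self (by positivity); exact one_le_pow₀ (by nlinarith [sq_nonneg (τ * r)]))
  have hKnn : ∀ r : ℝ, 0 ≤ kerDil τ r := fun r => kerDil_nonneg hτ.le r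
  have hfn : IntervalIntegrable (fun t => |f t|) volume T (2 * T) := hf.norm
  -- pointwise: `|∫ K f| ≤ ∫ K |f|`
  have hpt : ∀ u : ℝ, |∫ t in T..2 * T, kerDil τ (t - u) * f t| ≤ ∫ t in T..2 * T, kerDil τ (t - u) * |f t| := by
    intro u
    calc |∫ t in T..2 * T, kerDil τ (t - u) * f t| ≤ ∫ t in T..2 * T, |kerDil τ (t - u) * f t| := by
          have := intervalIntegral.norm_integral_le_integral_norm (μ := volume) (f := fun t => kerDil τ (t - u) * f t) hT2
          simpa only [Real.norm_eq_abs] using this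
      _ = ∫ t in T..2 * T, kerDil τ (t - u) * |f t| := by
          refine intervalIntegral.integral_congr fun t _ => ?_
          simp only [abs_mul, abs_of_nonneg (hKnn _)]
  -- integrate over `u`
  have hc1 : Continuous fun u : ℝ => |∫ t in T..2 * T, kerDil τ (t - u) * f t| := (continuous_conv hτ hf).abs
  have hc2 : Continuous fun u : ℝ => ∫ t in T..2 * T, kerDil τ (t - u) * |f t| := continuous_conv hτ hfn
  refine (intervalIntegral.integral_mono_on hab (hc1.intervalIntegrable _ _) (hc2.intervalIntegrable _ _)
    fun u _ => hpt u).trans ?_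
  -- Fubini for `(u, t) ↦ K(t − u) |f t|` on `(a,b] × (T, 2T]`
  have hcontK : Continuous (Function.uncurry fun (u t : ℝ) => kerDil τ (t - u)) :=
    (continuous_kerDil τ).comp (continuous_snd.sub continuous_fst)
  have h2 : Integrable (fun t => |f t|) (volume.restrict (Set.Ioc T (2 * T))) :=
    (intervalIntegrable_iff_integrableOn_Ioc_of_le hT2).1 hfn
  have hprod : Integrable (Function.uncurry fun (u t : ℝ) => kerDil τ (t - u) * |f t|)
      ((volume.restrict (Set.Ioc a b)).prod (volume.restrict (Set.Ioc T (2 * T)))) := by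
    have h1 : Integrable (fun _ : ℝ => τ * C) (volume.restrict (Set.Ioc a b)) :=
      ((continuous_const (y := τ * C)).integrableOn_Icc (a := a) (b := b)).mono_set Set.Ioc_subset_Icc_self
    refine (h1.mul_prod h2).mono' (hcontK.aestronglyMeasurable.mul h2.aestronglyMeasurable.comp_snd)
      (ae_of_all _ fun p => ?_)
    obtain ⟨u', t'⟩ := p
    simp only [Function.uncurry_apply_pair, Real.norm_eq_abs, abs_mul, abs_abs, abs_of_nonneg (hKnn _)]
    exact mul_le_mul_of_nonneg_right (hKbd _) (abs_nonneg _)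
  have hswap := MeasureTheory.integral_integral_swap hprod
  rw [intervalIntegral.integral_of_le hab]
  have hinner : ∀ u : ℝ, ∫ t in T..2 * T, kerDil τ (t - u) * |f t| = ∫ t in Set.Ioc T (2 * T), kerDil τ (t - u) * |f t| :=
    fun u => intervalIntegral.integral_of_le hT2
  simp_rw [hinner]
  rw [hswap]
  -- inner `u`-integral: `∫_{(a,b]} K(t − u) du ≤ ∫ K = 2π Re g₀(0)`
  have hKint : ∀ t : ℝ, Integrable fun u : ℝ => kerDil τ (t - u) := fun t =>
    (integrable_kerDil hτ).comp_sub_left t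
  have hKtot : ∀ t : ℝ, ∫ u : ℝ, kerDil τ (t - u) = 2 * π * (RudnickSarnakN.g0 0).re := by
    intro t
    rw [integral_sub_left_eq_self (fun u => kerDil τ u) volume t, integral_kerDil_real hτ]
  have hinner2 : ∀ t : ℝ, ∫ u in Set.Ioc a b, kerDil τ (t - u) * |f t| ≤ (2 * π * (RudnickSarnakN.g0 0).re) * |f t| := by
    intro t
    rw [MeasureTheory.integral_mul_const]
    refine mul_le_mul_of_nonneg_right ?_ (abs_nonneg _)
    rw [← hKtot t]
    exact setIntegral_le_integral (hKint t) (ae_of_all _ fun u => hKnn _)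
  calc ∫ t in Set.Ioc T (2 * T), ∫ u in Set.Ioc a b, kerDil τ (t - u) * |f t|
      ≤ ∫ t in Set.Ioc T (2 * T), (2 * π * (RudnickSarnakN.g0 0).re) * |f t| := by
        refine setIntegral_mono_on ?_ (h2.const_mul _) measurableSet_Ioc fun t _ => hinner2 t
        exact (hprod.swap.integral_prod_left).congr (ae_of_all _ fun t => rfl)
    _ = (2 * π * (RudnickSarnakN.g0 0).re) * ∫ t in T..2 * T, |f t| := by
        rw [MeasureTheory.integral_const_mul, intervalIntegral.integral_of_le hT2]

/-! ### The polar terms -/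

/-- **Polar terms**: for `T > 0`, `u ≥ T`, `0 ≤ h`, `τ > 0`,
`‖∫_u^{u+h} (ĝ_τ(−it) + ĝ_τ(1−it)) dt‖ ≤ 2 h e^{τ/8} D₀/(τ T²)`. [folklore] -/
theorem norm_integral_polar_le {τ : ℝ} (hτ : 1 ≤ τ) {T u h : ℝ} (hT : 0 < T) (hu : T ≤ u) (hh : 0 ≤ h) :
    ‖∫ t in u..u + h, (weilMellin (gDil τ) (-(t * I)) + weilMellin (gDil τ) (1 - t * I))‖ ≤
      2 * h * Real.exp (τ / 8) * decayD0 / (τ * T ^ 2) := by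
  have hD := decayD0_nonneg
  have hb : ∀ t ∈ Set.uIoc u (u + h), ‖weilMellin (gDil τ) (-(t * I)) + weilMellin (gDil τ) (1 - t * I)‖ ≤
      2 * Real.exp (τ / 8) * decayD0 / (τ * T ^ 2) := by
    intro t ht
    rw [Set.uIoc_of_le (by linarith)] at ht
    have ht0 : T ≤ t := by linarith [ht.1]
    have hτ0 : 0 < τ := by linarith
    obtain ⟨h1, h2⟩ := norm_polar_le hτ0 t
    have hTt : T ^ 2 ≤ t ^ 2 := pow_le_pow_left₀ hT.le ht0 2
    have e1 : (τ * t) ^ 2 = τ ^ 2 * t ^ 2 := by ring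
    have e3 : τ ^ 2 * T ^ 2 ≤ τ ^ 2 * t ^ 2 := mul_le_mul_of_nonneg_left hTt (sq_nonneg τ)
    have hle : τ * Real.exp (τ / 8) * decayD0 / (1 + (τ * t) ^ 2) ≤ Real.exp (τ / 8) * decayD0 / (τ * T ^ 2) := by
      rw [div_le_div_iff₀ (by positivity) (by positivity)]
      have h0 : 0 ≤ Real.exp (τ / 8) * decayD0 := by positivity
      calc τ * Real.exp (τ / 8) * decayD0 * (τ * T ^ 2) = (Real.exp (τ / 8) * decayD0) * (τ ^ 2 * T ^ 2) := by ring
        _ ≤ (Real.exp (τ / 8) * decayD0) * (1 + (τ * t) ^ 2) := by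
            refine mul_le_mul_of_nonneg_left ?_ h0
            rw [e1]; linarith
    calc ‖weilMellin (gDil τ) (-(t * I)) + weilMellin (gDil τ) (1 - t * I)‖
        ≤ ‖weilMellin (gDil τ) (-(t * I))‖ + ‖weilMellin (gDil τ) (1 - t * I)‖ := norm_add_le _ _
      _ ≤ 2 * (τ * Real.exp (τ / 8) * decayD0 / (1 + (τ * t) ^ 2)) := by linarith
      _ ≤ 2 * (Real.exp (τ / 8) * decayD0 / (τ * T ^ 2)) := by linarith
      _ = _ := by ring
  have := intervalIntegral.norm_integral_le_of_norm_le_const hb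
  rw [show |u + h - u| = h by rw [add_sub_cancel_left, abs_of_nonneg hh]] at this
  calc _ ≤ 2 * Real.exp (τ / 8) * decayD0 / (τ * T ^ 2) * h := this
    _ = _ := by ring

end Literature.NumberTheory.LFunctions.SelbergDelta
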